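import Literature.AlgebraicGeometry.Motives.ProjClosedFractions
import Literature.Algebra.Homology.LaurentCechEvalSes
import HarnessLib

/-!
# The sections of `𝒪_Z(d)` on the standard affine pieces of an integral closed `Z ⊆ 𝐏ⁿ_A` as an
# evaluated Laurent family (dictionary for Serre's theorems in Čech form)

Let `ι : Z → 𝐏ⁿ_A` be a closed immersion from an integral scheme, `A` acting on `K(Z)` through the
structure morphism (`AlgCompat`-style hypothesis `hA`). After a triangular change of the linear
coordinates `ℓ_j = x_j + c_j x_{a₀}` (`ProjTwist.ell`; `c_{a₀} = 0`, chosen by the user so that no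
`ℓ_j` vanishes on `Z`), the rational functions `θ_j = ℓ_j/x_{a₀} ∈ K(Z)` (`ProjTwist.theta`, through
the tree's dehomogenisation `ProjFrac.dehomFn`) are units, and the Laurent evaluation
`evalθ θ : A[x^{±1}] → K(Z)` of `Literature/Algebra/Homology/LaurentCechEval` satisfies
`evalθ (toL F) = dehomFn (α F)` for the graded `A`-automorphism `α : x_j ↦ ℓ_j`
(`ProjTwist.evalθ_toL`). Consequently (`ProjTwist.mem_evFam_iff`) the evaluated family of
`Literature/Algebra/Homology/LaurentCechEvalSes` is, member by member,

  `evFam A θ 1 0 d t = { z ∈ K(Z) | θ_k^{-d} z is regular on Z ∩ D₊(ℓ_t) }`   (`t ≠ ∅`, `k ∈ t`),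

i.e. the sections over `Z_{ℓ_t} = ⋂_{j ∈ t} (Z ∩ D₊(ℓ_j))` of the invertible sheaf `𝒪_Z(dH)`,
`H = V₊(x_{a₀})`, read inside `K(Z)` (Hartshorne II Prop. 5.11–5.13; Görtz–Wedhorn I, (13.6)).
Together with `LaurentCech.moduleFinite_homology_evCplx` and
`LaurentCech.exists_forall_isZero_homology_evCplx` this is Serre's finiteness and vanishing
theorem for the twists `𝒪_Z(d)` on the affine cover `(Z_{ℓ_j})_j`, in the Čech form consumed by the
finiteness theorem for proper morphisms (Görtz–Wedhorn II, Thm. 23.17 via Chow's lemma).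

Everything is proved; no named facts. Mathlib searched (pin): `MvPolynomial.aeval`,
`MvPolynomial.IsHomogeneous` API (used); no twisting sheaves on `Proj` beyond the structure sheaf.

## References

* R. Hartshorne, *Algebraic Geometry*, GTM 52 (1977): II Prop. 5.11–5.13, III Thm. 5.2.
  [Hartshorne1977]
* U. Görtz, T. Wedhorn, *Algebraic Geometry I: Schemes*, 2nd ed. (2020): (13.6)–(13.8).
  [GortzWedhorn2020]
* U. Görtz, T. Wedhorn, *Algebraic Geometry II* (2023): Thm. 22.22, Thm. 23.17. [GortzWedhorn2023]
-/

noncomputable section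

open CategoryTheory AlgebraicGeometry TopologicalSpace Opposite HomogeneousLocalization
open Literature.Algebra.Homology Literature.Algebra.Homology.LaurentCech
open Literature.AlgebraicGeometry.Morphisms Literature.AlgebraicGeometry.Morphisms.ProjCech
open Literature.AlgebraicGeometry.Motives.RatFn Literature.AlgebraicGeometry.Motives.ProjFrac

universe u

attribute [local instance] MvPolynomial.gradedAlgebra
  Literature.AlgebraicGeometry.Motives.ProjBaseChange.algebraBase

namespace Literature.AlgebraicGeometry.Motives

namespace ProjTwist

variable {A : Type u} [CommRing A] {n : ℕ}

/-! ### The twisted linear coordinates `ℓ_j = x_j + c_j x_{a₀}` and the automorphism `α` -/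

section Linear

variable (c : Fin (n + 1) → A) (a₀ : Fin (n + 1))

/-- The linear form `ℓ_j = x_j + c_j x_{a₀}`. [folklore] -/
def ell (j : Fin (n + 1)) : MvPolynomial (Fin (n + 1)) A :=
  MvPolynomial.X j + MvPolynomial.C (c j) * MvPolynomial.X a₀

/-- `ℓ_j` is homogeneous of degree `1`. [folklore] -/
theorem ell_mem (j : Fin (n + 1)) : ell c a₀ j ∈ grading A n 1 := by
  rw [MvPolynomial.mem_homogeneousSubmodule, ell]
  refine (MvPolynomial.isHomogeneous_X A j).add ?_
  have h := (MvPolynomial.isHomogeneous_C (Fin (n + 1)) (c j)).mul (MvPolynomial.isHomogeneous_X A a₀)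
  simpa using h

/-- **The graded `A`-algebra endomorphism `α : x_j ↦ ℓ_j`.** [folklore] -/
def α : MvPolynomial (Fin (n + 1)) A →ₐ[A] MvPolynomial (Fin (n + 1)) A :=
  MvPolynomial.aeval fun j => ell c a₀ j

/-- `α x_j = ℓ_j`. [folklore] -/
@[simp] theorem α_X (j : Fin (n + 1)) : α c a₀ (MvPolynomial.X j) = ell c a₀ j :=
  MvPolynomial.aeval_X _ j

/-- **`α` preserves homogeneity and degrees** (it substitutes linear forms for the variables).
[folklore] -/
theorem isHomogeneous_α {F : MvPolynomial (Fin (n + 1)) A} {N : ℕ} (hF : F.IsHomogeneous N) :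
    (α c a₀ F).IsHomogeneous N := by
  classical
  -- write `F` as a sum of monomials
  rw [α, MvPolynomial.aeval_eq_bind₁, ← MvPolynomial.support_sum_monomial_coeff F, map_sum]
  refine MvPolynomial.IsHomogeneous.sum _ _ _ fun m hm => ?_
  rw [MvPolynomial.bind₁_monomial]
  have hdeg : m.degree = N := by
    have := hF (MvPolynomial.mem_support_iff.1 hm)
    rw [← this, Finsupp.degree_eq_weight_one]
    rfl
  have h1 : (MvPolynomial.C (MvPolynomial.coeff m F) : MvPolynomial (Fin (n + 1)) A).IsHomogeneous 0 :=
    MvPolynomial.isHomogeneous_C _ _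
  have h2 : (∏ i ∈ m.support, ell c a₀ i ^ m i).IsHomogeneous (∑ i ∈ m.support, 1 * m i) := by
    refine MvPolynomial.IsHomogeneous.prod _ _ _ fun i _ => ?_
    exact (ell_mem c a₀ i).pow (m i)
  have h3 := h1.mul h2
  rw [zero_add] at h3
  convert h3 using 1
  rw [← hdeg, Finsupp.degree]
  simp

/-- `α F ∈ A[x]_N` for `F ∈ A[x]_N`. [folklore] -/
theorem α_mem {F : MvPolynomial (Fin (n + 1)) A} {N : ℕ} (hF : F ∈ grading A n N) :
    α c a₀ F ∈ grading A n N :=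
  (MvPolynomial.mem_homogeneousSubmodule _ _).2
    (isHomogeneous_α c a₀ ((MvPolynomial.mem_homogeneousSubmodule _ _).1 hF))

variable (hc : c a₀ = 0)
include hc

/-- `ℓ_{a₀} = x_{a₀}` (as `c_{a₀} = 0`). [folklore] -/
theorem ell_self : ell c a₀ a₀ = MvPolynomial.X a₀ := by
  rw [ell, hc, MvPolynomial.C_0, zero_mul, add_zero]

/-- The inverse substitution `β : x_j ↦ x_j - c_j x_{a₀}`. [folklore] -/
def β : MvPolynomial (Fin (n + 1)) A →ₐ[A] MvPolynomial (Fin (n + 1)) A :=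
  MvPolynomial.aeval fun j => MvPolynomial.X j - MvPolynomial.C (c j) * MvPolynomial.X a₀

/-- `α ∘ β = id`. [folklore] -/
theorem α_comp_β : (α c a₀).comp (β c a₀) = AlgHom.id A _ := by
  refine MvPolynomial.algHom_ext fun j => ?_
  rw [AlgHom.comp_apply, β, MvPolynomial.aeval_X, map_sub, map_mul, α_X, α_X, MvPolynomial.algHom_C,
    ell_self c a₀ hc, ell, AlgHom.id_apply, MvPolynomial.algebraMap_eq]
  ring

/-- **`α` is surjective** (with inverse `β`). [folklore] -/
theorem α_β (G : MvPolynomial (Fin (n + 1)) A) : α c a₀ (β c a₀ G) = G := by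
  have := congrArg (fun φ => φ G) (α_comp_β c a₀ hc)
  simpa using this

omit hc in
/-- `β` preserves homogeneity and degrees. [folklore] -/
theorem β_mem {G : MvPolynomial (Fin (n + 1)) A} {N : ℕ} (hG : G ∈ grading A n N) :
    β c a₀ G ∈ grading A n N := by
  -- `β` is `α` for the coefficients `-c`
  have h : β c a₀ = α (fun j => -c j) a₀ := by
    refine MvPolynomial.algHom_ext fun j => ?_
    rw [β, MvPolynomial.aeval_X, α_X, ell, MvPolynomial.C_neg]
    ring
  rw [h]
  exact α_mem _ a₀ hG

end Linear

/-! ### The units `θ_j = ℓ_j / x_{a₀}` and the Laurent evaluation -/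

section Theta

variable {Z : Scheme.{u}} [IsIntegral Z] (ι : Z ⟶ PP A n) (c : Fin (n + 1) → A) (a₀ : Fin (n + 1))
  (ha₀ : genericPoint Z ∈ ZH ι (MvPolynomial.X a₀)) (hℓ : ∀ j, genericPoint Z ∈ ZH ι (ell c a₀ j))

/-- **The rational functions `θ_j = ℓ_j / x_{a₀} ∈ K(Z)`.** [folklore] -/
def theta (j : Fin (n + 1)) : Z.functionField := dehomFn ι a₀ ha₀ (ell c a₀ j)

include hℓ in
/-- The `θ_j` are non-zero, hence units of the field `K(Z)` (no `ℓ_j` vanishes on `Z`).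
[folklore] -/
theorem isUnit_theta (j : Fin (n + 1)) : IsUnit (theta ι c a₀ ha₀ j) :=
  (dehomFn_ne_zero ι ha₀ (ell_mem c a₀ j) one_pos (hℓ j)).isUnit

variable [Algebra A Z.functionField]
variable (hA : ∀ a : A, algebraMap A Z.functionField a =
  ofSection (U := ⊤) (Set.mem_univ _) ((ι ≫ toSpec A n).appTop ((Scheme.ΓSpecIso (.of A)).inv a)))

include hA in
/-- Under the compatibility `hA`, `dehomFn` of a constant is the scalar. [folklore] -/
theorem dehomFn_C (a : A) : dehomFn ι a₀ ha₀ (MvPolynomial.C a) = algebraMap A Z.functionField a := by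
  rw [hA, dehomFn, RingHom.comp_apply, dehomAway_C, fracFn_apply,
    evalAway_algebraMap ι (ProjectiveSpace.X_mem a₀) one_pos, ofSection_map]

include hA in
/-- **The Laurent evaluation at `θ` is dehomogenisation after `α`**: `evalθ (toL F) = (α F)(x/x_{a₀})`
in `K(Z)` — two ring homomorphisms `A[x] → K(Z)` agreeing on the variables and the constants.
[folklore] -/
theorem evalθ_toL (F : MvPolynomial (Fin (n + 1)) A) :
    evalθ (A := A) (theta ι c a₀ ha₀) (isUnit_theta ι c a₀ ha₀ hℓ) (toL A n F) =
      dehomFn ι a₀ ha₀ (α c a₀ F) := by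
  rw [LaurentCech.evalθ_toL]
  have h : ((MvPolynomial.aeval (theta ι c a₀ ha₀) : MvPolynomial (Fin (n + 1)) A →ₐ[A] _) :
      MvPolynomial (Fin (n + 1)) A →+* Z.functionField) =
      (dehomFn ι a₀ ha₀).comp (α c a₀ : MvPolynomial (Fin (n + 1)) A →+* _) := by
    refine MvPolynomial.ringHom_ext (fun a => ?_) (fun j => ?_)
    · rw [RingHom.coe_coe, MvPolynomial.algHom_C, RingHom.comp_apply, RingHom.coe_coe,
        MvPolynomial.algHom_C, MvPolynomial.algebraMap_eq, dehomFn_C ι a₀ ha₀ hA]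
    · rw [RingHom.coe_coe, MvPolynomial.aeval_X, RingHom.comp_apply, RingHom.coe_coe, α_X]
      rfl
  exact congrArg (fun φ : MvPolynomial (Fin (n + 1)) A →+* Z.functionField => φ F) h

end Theta

/-! ### Auxiliary facts on the opens `Z_H` and on Laurent degrees -/

section Aux

variable {Z : Scheme.{u}} (ι : Z ⟶ PP A n) (c : Fin (n + 1) → A) (a₀ : Fin (n + 1))

/-- `Z_1 = Z`. [folklore] -/
theorem ZH_one : ZH ι (1 : MvPolynomial (Fin (n + 1)) A) = ⊤ := by
  rw [ZH, Proj.basicOpen_one, Scheme.Hom.preimage_top]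

/-- `Z_H ⊆ Z_{H^m}`. [folklore] -/
theorem ZH_le_ZH_pow (H : MvPolynomial (Fin (n + 1)) A) (m : ℕ) : ZH ι H ≤ ZH ι (H ^ m) := by
  rcases Nat.eq_zero_or_pos m with rfl | hm
  · rw [pow_zero, ZH_one]; exact le_top
  · rw [ZH_pow ι H hm]

/-- `Z_{ℓ_t} ⊆ Z_{ℓ_k}` for `k ∈ t`. [folklore] -/
theorem ZH_α_Xs_le {t : Finset (Fin (n + 1))} {k : Fin (n + 1)} (hk : k ∈ t) :
    ZH ι (α c a₀ (Xs A t)) ≤ ZH ι (ell c a₀ k) := by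
  classical
  rw [Xs, ← Finset.mul_prod_erase t _ hk, map_mul, α_X, ZH_mul]
  exact inf_le_left

omit c a₀ in
/-- A polynomial whose Laurent image sits in a negative degree vanishes. [folklore] -/
theorem eq_zero_of_toL_mem_Ldeg_neg {F : MvPolynomial (Fin (n + 1)) A} {D : ℤ} (hD : D < 0)
    (hF : toL A n F ∈ Ldeg A n D) : F = 0 := by
  apply toL_injective
  rw [map_zero]
  ext m
  rw [mem_Ldeg] at hF
  by_contra h
  have h' : (toL A n F).coeff m ≠ 0 := h
  have hm := hF m h'
  have hnonneg : ∀ i, 0 ≤ m i := by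
    intro i
    by_contra hneg
    exact h' (coeff_toL_eq_zero F ⟨i, not_le.1 hneg⟩)
  have : 0 ≤ edeg n m := by
    rw [edeg_apply]; exact Finset.sum_nonneg fun i _ => hnonneg i
  omega

omit c a₀ in
/-- `evalVec` for the rank-one free module with section `1`: `evalVec v = evalθ (v pt)`. [folklore] -/
theorem evalVec_unit_one [IrreducibleSpace Z] [Algebra A Z.functionField]
    (θ : Fin (n + 1) → Z.functionField)
    (hθ : ∀ j, IsUnit (θ j)) (v : Unit → L A n) :
    evalVec (A := A) θ hθ (fun _ : Unit => (1 : Z.functionField)) v = evalθ θ hθ (v ()) := by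
  rw [evalVec_apply, Fintype.sum_unique, one_mul]

end Aux

/-! ### Laurent monomials under the evaluation -/

section Monomials

variable {Z : Scheme.{u}} [IsIntegral Z] (ι : Z ⟶ PP A n) (c : Fin (n + 1) → A) (a₀ : Fin (n + 1))
  (ha₀ : genericPoint Z ∈ ZH ι (MvPolynomial.X a₀)) (hℓ : ∀ j, genericPoint Z ∈ ZH ι (ell c a₀ j))

/-- **`(α X_t)(x/x_{a₀}) = Π_{j ∈ t} θ_j`**: the rational function of `ℓ_t = Π_{j ∈ t} ℓ_j`
relative to `x_{a₀}`. [folklore] -/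
theorem dehomFn_α_Xs (t : Finset (Fin (n + 1))) :
    dehomFn ι a₀ ha₀ (α c a₀ (Xs A t)) = ∏ j ∈ t, theta ι c a₀ ha₀ j := by
  rw [Xs, map_prod, map_prod]
  exact Finset.prod_congr rfl fun j _ => by rw [α_X]; rfl

include hℓ in
/-- `Π_{j ∈ t} θ_j ≠ 0`. [folklore] -/
theorem prod_theta_ne_zero (t : Finset (Fin (n + 1))) : ∏ j ∈ t, theta ι c a₀ ha₀ j ≠ 0 :=
  Finset.prod_ne_zero_iff.2 fun j _ => (isUnit_theta ι c a₀ ha₀ hℓ j).ne_zero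

include hℓ in
/-- The generic point lies in every `Z_{ℓ_t}`. [folklore] -/
theorem genericPoint_mem_ZH_α_Xs (t : Finset (Fin (n + 1))) :
    genericPoint Z ∈ ZH ι (α c a₀ (Xs A t)) := by
  classical
  rw [Xs, map_prod]
  induction t using Finset.induction_on with
  | empty => rw [Finset.prod_empty, ZH_one]; trivial
  | insert a t hat ih =>
    rw [Finset.prod_insert hat, ZH_mul]
    exact ⟨(α_X c a₀ a).symm ▸ hℓ a, ih⟩

variable [Algebra A Z.functionField]

/-- **`evalθ (x_t^N) = (Π_{j ∈ t} θ_j)^N`** (`N ∈ ℤ`). [folklore] -/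
theorem evalθ_xs (t : Finset (Fin (n + 1))) (N : ℤ) :
    evalθ (A := A) (theta ι c a₀ ha₀) (isUnit_theta ι c a₀ ha₀ hℓ) (xs A t N) =
      (∏ j ∈ t, theta ι c a₀ ha₀ j) ^ N := by
  have hnat : ∀ M : ℕ, evalθ (A := A) (theta ι c a₀ ha₀) (isUnit_theta ι c a₀ ha₀ hℓ)
      (xs A t (M : ℤ)) = (∏ j ∈ t, theta ι c a₀ ha₀ j) ^ M := fun M => by
    rw [← toL_Xs_pow, LaurentCech.evalθ_toL, map_pow, Xs, map_prod]
    simp only [MvPolynomial.aeval_X]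
  obtain ⟨M, rfl | rfl⟩ := Int.eq_nat_or_neg N
  · rw [hnat M, zpow_natCast]
  · have h1 := hnat M
    have h2 : evalθ (A := A) (theta ι c a₀ ha₀) (isUnit_theta ι c a₀ ha₀ hℓ) (xs A t (M : ℤ)) *
        evalθ (A := A) (theta ι c a₀ ha₀) (isUnit_theta ι c a₀ ha₀ hℓ) (xs A t (-(M : ℤ))) = 1 := by
      rw [← map_mul, xs_mul_xs_neg, map_one]
    rw [h1] at h2
    rw [zpow_neg, zpow_natCast, ← eq_inv_of_mul_eq_one_right h2]

end Monomials

/-! ### The dictionary: `evFam` is the family of sections of `𝒪_Z(d)` -/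

section Dictionary

variable {Z : Scheme.{u}} [IsIntegral Z] (ι : Z ⟶ PP A n) [IsClosedImmersion ι]
  (c : Fin (n + 1) → A) (a₀ : Fin (n + 1)) (hc : c a₀ = 0)
  (ha₀ : genericPoint Z ∈ ZH ι (MvPolynomial.X a₀)) (hℓ : ∀ j, genericPoint Z ∈ ZH ι (ell c a₀ j))
  [Algebra A Z.functionField]
  (hA : ∀ a : A, algebraMap A Z.functionField a =
    ofSection (U := ⊤) (Set.mem_univ _) ((ι ≫ toSpec A n).appTop ((Scheme.ΓSpecIso (.of A)).inv a)))

include hc hℓ hA in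
/-- **The dictionary.** For `t ≠ ∅`, `k ∈ t` and `d ∈ ℤ`, a rational function `z ∈ K(Z)` lies in the
evaluated family `evFam A θ 1 0 d t` (the `A`-span of the `θ^m θ_t^{-N}`, `deg m = d + N #t`) iff
`θ_k^{-d} z` is regular on `Z_{ℓ_t} = Z ∩ D₊(ℓ_t)`, i.e. iff `z ∈ Γ(Z_{ℓ_t}, 𝒪_Z(dH))` for the
hyperplane `H = V₊(x_{a₀})` with local equations `θ_j⁻¹ = x_{a₀}/ℓ_j` (Görtz–Wedhorn I, (13.6):
`Γ(D₊(f), 𝒪(d)) = (S_f)_d`; here for the integral closed subscheme `Z`, through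
`ProjFrac.exists_fracFn_eq_of_forall_isRegularAt` and `ProjFrac.fracFn_mk_eq_div`).
[cite: GortzWedhorn2020, (13.6)–(13.8) (pp. 391–395)] -/
theorem mem_evFam_iff {t : Finset (Fin (n + 1))} (ht : t.Nonempty) {k : Fin (n + 1)} (hk : k ∈ t)
    (d : ℤ) (z : Z.functionField) :
    z ∈ evFam A (theta ι c a₀ ha₀) (isUnit_theta ι c a₀ ha₀ hℓ) (fun _ : Unit => (1 : Z.functionField))
        (0 : Unit → ℤ) d t ↔
      ∀ y ∈ ZH ι (α c a₀ (Xs A t)), IsRegularAt y ((theta ι c a₀ ha₀ k ^ d)⁻¹ * z) := by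
  classical
  -- notation and basic facts
  have hθ := isUnit_theta ι c a₀ ha₀ hℓ
  have hΘ0 : (∏ j ∈ t, theta ι c a₀ ha₀ j) ≠ 0 := prod_theta_ne_zero ι c a₀ ha₀ hℓ t
  have hθk0 : theta ι c a₀ ha₀ k ≠ 0 := (hθ k).ne_zero
  have hHt : α c a₀ (Xs A t) ∈ grading A n t.card := α_mem c a₀ (Xs_mem t)
  have hcard : 0 < t.card := Finset.card_pos.2 ht
  have hnet : genericPoint Z ∈ ZH ι (α c a₀ (Xs A t)) := genericPoint_mem_ZH_α_Xs ι c a₀ hℓ t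
  -- `d = d⁺ - d⁻`
  set dp : ℕ := d.toNat with hdp
  set dm : ℕ := (-d).toNat with hdm
  have hd : d = (dp : ℤ) - dm := by omega
  have hzpow : theta ι c a₀ ha₀ k ^ d = theta ι c a₀ ha₀ k ^ dp / theta ι c a₀ ha₀ k ^ dm := by
    rw [hd, zpow_sub₀ hθk0, zpow_natCast, zpow_natCast]
  constructor
  · -- `→`: an evaluated localized element is a fraction with denominator `ℓ_k^{d⁺} ℓ_t^N ℓ_k`
    intro hz
    obtain ⟨v, ⟨hloc, hdeg⟩, rfl⟩ := (mem_evFam A _ hθ _ _).1 hz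
    rw [evalVec_unit_one]
    obtain ⟨N, F', -, hNv⟩ := hloc
    have hx : xs A t N * v () = toL A n (F' ()) := by
      have := congr_fun hNv ()
      simpa using this
    have hxdeg : v () ∈ Ldeg A n d := by
      have := (mem_Kdeg (A := A) (r := n) (e := (0 : Unit → ℤ))).1 hdeg ()
      simpa using this
    have hFdeg : toL A n (F' ()) ∈ Ldeg A n (N * t.card + d) := by
      rw [← hx]; exact mul_mem_Ldeg (xs_mem_Ldeg t N) hxdeg
    have hxeq : v () = xs A t (-(N : ℤ)) * toL A n (F' ()) := by
      rw [← hx, ← mul_assoc, xs_neg_mul_xs, one_mul]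
    by_cases hD : 0 ≤ (N : ℤ) * t.card + d
    swap
    · -- negative total degree: `v () = 0`
      have hF0 : F' () = 0 := eq_zero_of_toL_mem_Ldeg_neg (not_le.1 hD) hFdeg
      intro y _
      rw [hxeq, hF0, map_zero, mul_zero, map_zero, mul_zero]
      exact isRegularAt_zero
    obtain ⟨D, hDdef⟩ : ∃ D : ℕ, (D : ℤ) = N * t.card + d := ⟨((N : ℤ) * t.card + d).toNat, by omega⟩
    have hFmem : F' () ∈ grading A n D := by
      rw [MvPolynomial.mem_homogeneousSubmodule, ← toL_mem_Ldeg_iff, hDdef]; exact hFdeg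
    -- the fraction
    set G : MvPolynomial (Fin (n + 1)) A := α c a₀ (F' ()) * ell c a₀ k ^ dm * ell c a₀ k with hGdef
    set Hd : MvPolynomial (Fin (n + 1)) A :=
      ell c a₀ k ^ dp * α c a₀ (Xs A t) ^ N * ell c a₀ k with hHddef
    have hδ : 0 < dp + N * t.card + 1 := Nat.succ_pos _
    have hHd : Hd ∈ grading A n (dp + N * t.card + 1) := by
      refine SetLike.mul_mem_graded (SetLike.mul_mem_graded ?_ ?_) (ell_mem c a₀ k)
      · simpa using SetLike.pow_mem_graded dp (ell_mem c a₀ k)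
      · simpa [mul_comm] using SetLike.pow_mem_graded N hHt
    have hG : G ∈ grading A n (1 • (dp + N * t.card + 1)) := by
      have e : 1 • (dp + N * t.card + 1) = D + dm + 1 := by rw [one_nsmul]; omega
      rw [e]
      refine SetLike.mul_mem_graded (SetLike.mul_mem_graded (α_mem c a₀ hFmem) ?_) (ell_mem c a₀ k)
      simpa using SetLike.pow_mem_graded dm (ell_mem c a₀ k)
    have hne : genericPoint Z ∈ ZH ι Hd := by
      rw [hHddef, ZH_mul, ZH_mul]
      exact ⟨⟨ZH_le_ZH_pow ι _ dp (hℓ k), ZH_le_ZH_pow ι _ N hnet⟩, hℓ k⟩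
    -- its rational function is `θ_k^{-d} z`
    have hθk : dehomFn ι a₀ ha₀ (ell c a₀ k) = theta ι c a₀ ha₀ k := rfl
    have hGv : dehomFn ι a₀ ha₀ G =
        dehomFn ι a₀ ha₀ (α c a₀ (F' ())) * theta ι c a₀ ha₀ k ^ dm * theta ι c a₀ ha₀ k := by
      rw [hGdef, map_mul, map_mul, map_pow, hθk]
    have hHdv : dehomFn ι a₀ ha₀ Hd =
        theta ι c a₀ ha₀ k ^ dp * (∏ j ∈ t, theta ι c a₀ ha₀ j) ^ N * theta ι c a₀ ha₀ k := by
      rw [hHddef, map_mul, map_mul, map_pow, map_pow, dehomFn_α_Xs, hθk]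
    have hevv : evalθ (A := A) (theta ι c a₀ ha₀) hθ (v ()) =
        ((∏ j ∈ t, theta ι c a₀ ha₀ j) ^ N)⁻¹ * dehomFn ι a₀ ha₀ (α c a₀ (F' ())) := by
      rw [hxeq, map_mul, evalθ_xs ι c a₀ ha₀ hℓ, evalθ_toL ι c a₀ ha₀ hℓ hA, zpow_neg, zpow_natCast]
    have hval : fracFn ι Hd hne (Away.mk (grading A n) hHd 1 G hG) =
        (theta ι c a₀ ha₀ k ^ d)⁻¹ *
          evalθ (A := A) (theta ι c a₀ ha₀) hθ (v ()) := by
      rw [fracFn_mk_eq_div ι ha₀ hHd hδ hne 1 hG, pow_one, hGv, hHdv, hevv, hzpow]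
      field_simp
    intro y hy
    have hy' : y ∈ ZH ι Hd := by
      rw [hHddef, ZH_mul, ZH_mul]
      exact ⟨⟨ZH_le_ZH_pow ι _ dp (ZH_α_Xs_le ι c a₀ hk hy), ZH_le_ZH_pow ι _ N hy⟩,
        ZH_α_Xs_le ι c a₀ hk hy⟩
    rw [← hval]
    exact isRegularAt_fracFn ι Hd hy' _
  · -- `←`: a rational function with `θ_k^{-d} z` regular on `Z_{ℓ_t}` is evaluated from `(L_{x_t})_d`
    intro hreg
    obtain ⟨q, hq⟩ := exists_fracFn_eq_of_forall_isRegularAt ι hHt hcard hnet hreg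
    obtain ⟨m, G, hG, rfl⟩ := q.mk_surjective _ hHt
    rw [fracFn_mk_eq_div ι ha₀ hHt hcard hnet m hG, dehomFn_α_Xs] at hq
    -- `G = α F`
    set F := β c a₀ G with hFdef
    have hαF : α c a₀ F = G := α_β c a₀ hc G
    have hFmem : F ∈ grading A n (m • t.card) := β_mem c a₀ hG
    have hFhom : F.IsHomogeneous (m * t.card) := by
      have := (MvPolynomial.mem_homogeneousSubmodule _ _).1 hFmem
      simpa using this
    -- the Laurent element
    set x : L A n := xs A {k} d * (toL A n F * xs A t (-(m : ℤ))) with hxdef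
    have hev : evalθ (A := A) (theta ι c a₀ ha₀) hθ x = z := by
      rw [hxdef, map_mul, map_mul, evalθ_xs ι c a₀ ha₀ hℓ, evalθ_xs ι c a₀ ha₀ hℓ,
        evalθ_toL ι c a₀ ha₀ hℓ hA, hαF, Finset.prod_singleton, zpow_neg, zpow_natCast,
        ← div_eq_mul_inv, hq, ← mul_assoc, mul_inv_cancel₀ (zpow_ne_zero d hθk0), one_mul]
    refine (mem_evFam A _ hθ _ _).2 ⟨fun _ => x, ⟨?_, ?_⟩, by rw [evalVec_unit_one, hev]⟩
    · -- localized at `x_t`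
      refine (mem_loc _).2 ⟨m + dm, fun _ => MvPolynomial.X k ^ dp * Xs A (t \ {k}) ^ dm * F,
        Submodule.mem_top, funext fun _ => ?_⟩
      rw [Pi.smul_apply, smul_eq_mul, ιK_apply, hxdef]
      have e1 : xs A t ((m + dm : ℕ) : ℤ) = xs A t m * xs A t dm := by rw [Nat.cast_add, xs_add]
      have e2 : xs A t (dm : ℤ) = xs A (t \ {k}) dm * xs A {k} dm :=
        xs_eq_sdiff_mul (Finset.singleton_subset_iff.2 hk) dm
      have e3 : xs A {k} d * xs A {k} (dm : ℤ) = toL A n (MvPolynomial.X k ^ dp) := by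
        rw [← xs_add, show d + dm = dp by omega, ← toL_Xs_pow, Xs_singleton]
      have e4 : xs A (t \ {k}) (dm : ℤ) = toL A n (Xs A (t \ {k}) ^ dm) := (toL_Xs_pow _ dm).symm
      have e5 : xs A t (m : ℤ) * xs A t (-(m : ℤ)) = 1 := xs_mul_xs_neg t m
      calc xs A t ((m + dm : ℕ) : ℤ) * (xs A {k} d * (toL A n F * xs A t (-(m : ℤ))))
          = (xs A t (m : ℤ) * xs A t (-(m : ℤ))) * ((xs A {k} d * xs A {k} (dm : ℤ)) *
              xs A (t \ {k}) (dm : ℤ)) * toL A n F := by rw [e1, e2]; ring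
        _ = toL A n (MvPolynomial.X k ^ dp * Xs A (t \ {k}) ^ dm * F) := by
          rw [e5, e3, e4, one_mul, ← map_mul, ← map_mul]
    · -- homogeneous of degree `d`
      refine (mem_Kdeg (A := A) (r := n) (e := (0 : Unit → ℤ))).2 fun _ => ?_
      rw [Pi.zero_apply, sub_zero, hxdef]
      have h1 : toL A n F ∈ Ldeg A n ((m * t.card : ℕ) : ℤ) := (toL_mem_Ldeg_iff F _).2 hFhom
      have h2 := mul_mem_Ldeg (xs_mem_Ldeg (A := A) {k} d) (mul_mem_Ldeg h1 (xs_mem_Ldeg t (-(m : ℤ))))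
      have e : d * (({k} : Finset (Fin (n + 1))).card : ℤ) +
          (((m * t.card : ℕ) : ℤ) + -(m : ℤ) * t.card) = d := by
        rw [Finset.card_singleton]; push_cast; ring
      rwa [e] at h2

end Dictionary

end ProjTwist

end Literature.AlgebraicGeometry.Motives

end
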